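import Literature.Probability.RandomPlanarGeometry.HexSAWStripWidthTwoFourthContactMoment
import Literature.Analysis.Asymptotics.FourthCentralMomentAlgebra
import HarnessLib

/-!
# The width-two strip at criticality: the FOURTH CUMULANT of the surface-contact count is linear in the length, and its rate is the exact constant
# `κ₄(T = 2) = (3339420 − 2361331√2)/32 = −0.19767…` per step (module «WIDTH-TWO CONTACT KURTOSIS»)

Topic `Literature/Probability/RandomPlanarGeometry` (continues «WIDTH-TWO FOURTH CONTACT MOMENT» `HexSAWStripWidthTwoFourthContactMoment.lean` — the quartic law
`W2.exists_hatC4D_two_quartic`, the constants `W2.quartA/B/C/DTwoDet`, `W2.pThree/pTwo/pOneTwoDet`, the statistic `W2.fourthTopTwo` and the Bell constant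
`W2.kappaHatFourTwo` — and the model-free «FOURTH CENTRAL MOMENT ALGEBRA» `Literature.Analysis.tendsto_ratio_fourth_central_sub_linear`).  Lane «pcv-sawmu»
(CriticalPhenomena venture), a-p2 g29.  With `K = k + 1` the laws of `D̂, Ĉ, Ĉ², Ĉ³, Ĉ⁴` are polynomials of degree `0…4` in `K`; the `K⁴, K³, K²` coefficients of
`E = S₀A³ − 4P₀C₀A² − 3Q₀²A² + 12Q₀C₀²A − 6C₀⁴` vanish identically in the free intercepts `m₀, m₂, m₃` (§1), the `K¹` coefficient is `κ̂₄·A⁴` with `κ̂₄` the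
Bell-formula constant (the intercepts cancel — `kurtRate_identity_two`), whence `(m₄ − 3Var²)(K) − κ̂₄K → W`.  At `T = 2` every scalar is in `ℚ(x_c²) = ℚ(√2)`:
`κ̂₄ = −691621/8 + 2361331x²/8 = 834855/4 − 2361331√2/16`, **`κ₄ = κ̂₄/2 = (3339420 − 2361331√2)/32 = −0.1976703757…`** (the venture's FINDING note
FINDING-WIDTH-THREE-CONTACT-VARIANCE-CONJECTURE.md §2 had «κ₄(T=2) ≈ −0.198 (rough)»; `L₁ = ½ + x²`, `L₂ = (96 − 67√2)/4`, `L₃ = 3459/2 − 9785√2/8` are the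
earlier cars).  Frame: W. Feller I (1968) XIII.6; nothing below is printed.

## What is proved (namespace `…SAW.HV.W2`)
* §1 `quartic_cancellation_four/three/two_two` (the `K⁴, K³, K²` cancellations), ★ `kurtRate_identity_two` (slope `= κ̂₄`),
  ★★★ **`tendsto_fourthTopTwo_sub_linear`** (`∃ W, fourthTopTwo (k+1) a b − κ̂₄(k+1) → W` for all levels `a, b`), `tendsto_fourthTopTwo_div`,
  ★★★ `tendsto_fourthTopTwo_div_hatLen` (per step `→ kappaStepFourTwo`).
* §2 `kappaHatTwo_closed_form`, ★ `kappaHatFourTwo_closed_form` (`κ̂₄ = −691621/8 + 2361331x²/8`), ★★★ **`kappaStepFourTwo_eq : κ₄(T=2) = (3339420 − 2361331√2)/32`**,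
  `kappaStepFourTwo_window` (`−0.1976704 < κ₄ < −0.1976703`).

Label: LANE THEOREM (own result of lane «pcv-sawmu», a-p2 g29, 2026-08-28; not in print).
-/

noncomputable section

open Finset Filter Topology Literature.Probability.LatticeModels Literature.Probability.Percolation

namespace Literature.Probability.RandomPlanarGeometry.SAW

namespace HV

namespace W2

/-! ## §1 The kurtosis law -/

/-- `T_y = −c·T_λ` (plumbing). [cite: Feller1968, XIII.6; lane plumbing] -/
private theorem tyTwo_eq_neg_mul (hT : tOneTwo ≠ 0) : tyTwo = -(cDetTwo * tOneTwo) := by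
  have : cDetTwo * tOneTwo = -tyTwo := by rw [cDetTwo]; field_simp
  linarith

set_option maxHeartbeats 4000000 in
/-- The `K⁴`-cancellation of the kurtosis statistic (`s₄ = c⁴A`, plumbing). [cite: Feller1968, XIII.6; lane «pcv-sawmu» a-p2 g29] -/
theorem quartic_cancellation_four_two (hT : tOneTwo ≠ 0) (A : ℝ) :
    A ^ 3 * (quartATwoDet A / 4) - 4 * A ^ 2 * (pThreeTwoDet A) * (cDetTwo * A) - 3 * A ^ 2 * (cDetTwo ^ 2 * A) ^ 2 + 12 * A * (cDetTwo ^ 2 * A) * (cDetTwo * A) ^ 2 - 6 * (cDetTwo * A) ^ 4 = 0 := by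
  simp only [quartATwoDet, quartSrc3TwoDet, pThreeTwoDet, cubATwoDet, cubSrc2TwoDet, tyTwo_eq_neg_mul hT]
  field_simp
  ring

set_option maxHeartbeats 4000000 in
/-- The `K³`-cancellation of the kurtosis statistic (plumbing). [cite: Feller1968, XIII.6; lane «pcv-sawmu» a-p2 g29] -/
theorem quartic_cancellation_three_two (hT : tOneTwo ≠ 0) (A m₀ : ℝ) :
    A ^ 3 * ((quartBTwoDet A m₀ / 3 - quartATwoDet A / 2) - 4 * (quartATwoDet A / 4)) - 4 * A ^ 2 * ((pThreeTwoDet A) * (m₀ - cDetTwo * A) + (pTwoTwoDet A m₀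
        - 3 * pThreeTwoDet A) * (cDetTwo * A)) - 6 * A ^ 2 * (cDetTwo ^ 2 * A) * (linQTwoDet A m₀ - 2 * (cDetTwo ^ 2 * A)) + 12 * A * (2 * (cDetTwo ^ 2 * A) * (cDetTwo * A) * (m₀
        - cDetTwo * A) + (linQTwoDet A m₀ - 2 * (cDetTwo ^ 2 * A)) * (cDetTwo * A) ^ 2) - 24 * (cDetTwo * A) ^ 3 * (m₀ - cDetTwo * A) = 0 := by
  simp only [quartBTwoDet, quartATwoDet, quartSrc2TwoDet, quartSrc3TwoDet, pTwoTwoDet, pThreeTwoDet, cubBTwoDet, cubATwoDet, cubSrc1TwoDet, cubSrc2TwoDet,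
    linQTwoDet, tyTwo_eq_neg_mul hT]
  field_simp
  ring

set_option maxHeartbeats 4000000 in
/-- The `K²`-cancellation of the kurtosis statistic (plumbing). [cite: Feller1968, XIII.6; lane «pcv-sawmu» a-p2 g29] -/
theorem quartic_cancellation_two_two (hT : tOneTwo ≠ 0) (A m₀ m₂ : ℝ) :
    A ^ 3 * ((quartATwoDet A / 4 - quartBTwoDet A m₀ / 2 + quartCTwoDet A m₀ m₂ / 2) - 3 * (quartBTwoDet A m₀ / 3 - quartATwoDet A / 2) + 6 * (quartATwoDet A / 4))
        - 4 * A ^ 2 * ((pTwoTwoDet A m₀ - 3 * pThreeTwoDet A) * (m₀ - cDetTwo * A) + (pOneTwoDet A m₀ m₂ - 2 * pTwoTwoDet A m₀ + 3 * pThreeTwoDet A) * (cDetTwo * A))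
        - 3 * A ^ 2 * ((linQTwoDet A m₀ - 2 * (cDetTwo ^ 2 * A)) ^ 2 + 2 * (cDetTwo ^ 2 * A) * (m₂ - linQTwoDet A m₀ + cDetTwo ^ 2 * A)) + 12 * A * ((cDetTwo ^ 2 * A) * (m₀
        - cDetTwo * A) ^ 2 + 2 * (linQTwoDet A m₀ - 2 * (cDetTwo ^ 2 * A)) * (cDetTwo * A) * (m₀ - cDetTwo * A) + (m₂ - linQTwoDet A m₀ + cDetTwo ^ 2 * A) * (cDetTwo * A) ^ 2)
      - 36 * (cDetTwo * A) ^ 2 * (m₀ - cDetTwo * A) ^ 2 = 0 := by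
  simp only [quartCTwoDet, quartBTwoDet, quartATwoDet, quartSrc1TwoDet, quartSrc2TwoDet, quartSrc3TwoDet, pOneTwoDet, pTwoTwoDet, pThreeTwoDet,
    cubCTwoDet, cubBTwoDet, cubATwoDet, cubSrc0TwoDet, cubSrc1TwoDet, cubSrc2TwoDet, linQTwoDet, tyTwo_eq_neg_mul hT]
  field_simp
  ring

set_option maxHeartbeats 8000000 in
/-- ★ The kurtosis-rate identity for `S₂`: the `K¹` coefficient of the statistic is `κ̂₄·A⁴` — the intercepts `m₀, m₂, m₃` cancel and the Bell formula appears.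
[cite: Feller1968, XIII.6; lane «pcv-sawmu» a-p2 g29 — own] -/
theorem kurtRate_identity_two (hT : tOneTwo ≠ 0) {A : ℝ} (hA : A ≠ 0) (m₀ m₂ m₃ : ℝ) :
    (A ^ 3 * ((quartBTwoDet A m₀ / 6 - quartCTwoDet A m₀ m₂ / 2 + quartDTwoDet A m₀ m₂ m₃) - 2 * (quartATwoDet A / 4 - quartBTwoDet A m₀ / 2 + quartCTwoDet A m₀ m₂ / 2)
        + 3 * (quartBTwoDet A m₀ / 3 - quartATwoDet A / 2) - 4 * (quartATwoDet A / 4)) - 4 * A ^ 2 * ((pOneTwoDet A m₀ m₂ - 2 * pTwoTwoDet A m₀ + 3 * pThreeTwoDet A) * (m₀ - cDetTwo * A)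
        + (m₃ - pOneTwoDet A m₀ m₂ + pTwoTwoDet A m₀ - pThreeTwoDet A) * (cDetTwo * A)) - 6 * A ^ 2 * (linQTwoDet A m₀ - 2 * (cDetTwo ^ 2 * A)) * (m₂ - linQTwoDet A m₀ + cDetTwo ^ 2 * A)
        + 12 * A * ((linQTwoDet A m₀ - 2 * (cDetTwo ^ 2 * A)) * (m₀ - cDetTwo * A) ^ 2 + 2 * (m₂ - linQTwoDet A m₀ + cDetTwo ^ 2 * A) * (cDetTwo * A) * (m₀ - cDetTwo * A))
        - 24 * (cDetTwo * A) * (m₀ - cDetTwo * A) ^ 3) / A ^ 4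
      = kappaHatFourTwo := by
  rw [div_eq_iff (pow_ne_zero 4 hA)]
  simp only [quartDTwoDet, quartCTwoDet, quartBTwoDet, quartATwoDet, quartSrc0TwoDet, quartSrc1TwoDet, quartSrc2TwoDet, quartSrc3TwoDet, pOneTwoDet, pTwoTwoDet, pThreeTwoDet,
    cubCTwoDet, cubBTwoDet, cubATwoDet, cubSrc0TwoDet, cubSrc1TwoDet, cubSrc2TwoDet, linQTwoDet, kappaHatFourTwo, kappaHatTwo, cThreeDetTwo, cTwoDetTwo, tyTwo_eq_neg_mul hT]
  field_simp
  ring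

set_option maxHeartbeats 1600000 in
/-- ★★★ **THE WIDTH-TWO CONTACT KURTOSIS LAW**: for every pair of levels `a, b` there is `W` with `fourthTopTwo (k+1) a b − κ̂₄·(k+1) → W` (`κ̂₄ = kappaHatFourTwo`):
the fourth cumulant `m₄ − 3Var²` of the surface-contact count is linear in the length.
[cite: Feller1968, XIII.6 (moments of the number of renewals); DuminilCopinHammond2013, §2.2; lane «pcv-sawmu» a-p2 g29 — own result, not in print] -/
theorem tendsto_fourthTopTwo_sub_linear (a b : Fin (2 * 2)) :
    ∃ W : ℝ, Tendsto (fun k : ℕ => fourthTopTwo (k + 1) a b - kappaHatFourTwo * ((k : ℝ) + 1)) atTop (𝓝 W) := by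
  obtain ⟨m₀, m₂, m₃, m₄, K, hb₁, hb₂, hb₃, hb₄⟩ := exists_hatC4D_two_quartic a b
  have hT : tOneTwo ≠ 0 := (exists_hatCD_two_linear_det a b).1
  obtain ⟨K₀, hK₀', hK₀⟩ := abs_hatD_two_sub_lim_le
  obtain ⟨hR0, hR1, -, -⟩ := rTwoDet_facts
  set A : ℝ := limTwo a b with hA
  have hApos : 0 < A := limTwo_pos a b
  have hAne : A ≠ 0 := hApos.ne'
  have hD : Tendsto (fun k : ℕ => ((k : ℝ) + 1) ^ 4 * (hatD 2 (stripYT 2) (k + 1) a b - A)) atTop (𝓝 0) :=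
    Literature.Analysis.tendsto_succ_pow_mul_of_abs_le (e := fun n => hatD 2 (stripYT 2) (n + 1) a b - A) hR0 hR1 (fun n => hK₀ a b n) 4
  have hC : Tendsto (fun k : ℕ => ((k : ℝ) + 1) ^ 3 * (hatCD (stripYT 2) (k + 1) a b - ((cDetTwo * A) * ((k : ℝ) + 1) + (m₀ - cDetTwo * A)))) atTop (𝓝 0) := by
    have h := Literature.Analysis.tendsto_succ_pow_mul_of_abs_le (e := fun n => hatCD (stripYT 2) (n + 1) a b - (cDetTwo * A * (n : ℝ) + m₀)) hR0 hR1 hb₁ 3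
    refine h.congr fun k => ?_
    ring
  have hQ : Tendsto (fun k : ℕ => ((k : ℝ) + 1) ^ 2 * (hatC2D (stripYT 2) (k + 1) a b - ((cDetTwo ^ 2 * A) * ((k : ℝ) + 1) ^ 2 + (linQTwoDet A m₀ - 2 * (cDetTwo ^ 2 * A)) * ((k : ℝ) + 1)
      + (m₂ - linQTwoDet A m₀ + cDetTwo ^ 2 * A)))) atTop (𝓝 0) := by
    have h := Literature.Analysis.tendsto_succ_pow_mul_of_abs_le (e := fun n => hatC2D (stripYT 2) (n + 1) a b - (cDetTwo ^ 2 * A * (n : ℝ) ^ 2 + linQTwoDet A m₀ * (n : ℝ) + m₂)) hR0 hR1 hb₂ 2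
    refine h.congr fun k => ?_
    ring
  have hP : Tendsto (fun k : ℕ => ((k : ℝ) + 1) * (hatC3DTwo (stripYT 2) (k + 1) a b - ((pThreeTwoDet A) * ((k : ℝ) + 1) ^ 3 + (pTwoTwoDet A m₀ - 3 * pThreeTwoDet A) * ((k : ℝ) + 1) ^ 2
      + (pOneTwoDet A m₀ m₂ - 2 * pTwoTwoDet A m₀ + 3 * pThreeTwoDet A) * ((k : ℝ) + 1) + (m₃ - pOneTwoDet A m₀ m₂ + pTwoTwoDet A m₀ - pThreeTwoDet A)))) atTop (𝓝 0) := by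
    have h := Literature.Analysis.tendsto_succ_pow_mul_of_abs_le (e := fun n => hatC3DTwo (stripYT 2) (n + 1) a b - (pThreeTwoDet A * (n : ℝ) ^ 3 + pTwoTwoDet A m₀ * (n : ℝ) ^ 2
        + pOneTwoDet A m₀ m₂ * (n : ℝ) + m₃)) hR0 hR1 hb₃ 1
    simp only [pow_one] at h
    refine h.congr fun k => ?_
    ring
  have hS : Tendsto (fun k : ℕ => hatC4DTwo (stripYT 2) (k + 1) a b - ((quartATwoDet A / 4) * ((k : ℝ) + 1) ^ 4 + ((quartBTwoDet A m₀ / 3 - quartATwoDet A / 2)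
      - 4 * (quartATwoDet A / 4)) * ((k : ℝ) + 1) ^ 3 + ((quartATwoDet A / 4 - quartBTwoDet A m₀ / 2 + quartCTwoDet A m₀ m₂ / 2) - 3 * (quartBTwoDet A m₀ / 3 - quartATwoDet A / 2)
      + 6 * (quartATwoDet A / 4)) * ((k : ℝ) + 1) ^ 2 + ((quartBTwoDet A m₀ / 6 - quartCTwoDet A m₀ m₂ / 2 + quartDTwoDet A m₀ m₂ m₃) - 2 * (quartATwoDet A / 4 - quartBTwoDet A m₀ / 2
      + quartCTwoDet A m₀ m₂ / 2) + 3 * (quartBTwoDet A m₀ / 3 - quartATwoDet A / 2) - 4 * (quartATwoDet A / 4)) * ((k : ℝ) + 1) + (m₄ - (quartBTwoDet A m₀ / 6 - quartCTwoDet A m₀ m₂ / 2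
      + quartDTwoDet A m₀ m₂ m₃) + (quartATwoDet A / 4 - quartBTwoDet A m₀ / 2 + quartCTwoDet A m₀ m₂ / 2) - (quartBTwoDet A m₀ / 3 - quartATwoDet A / 2)
      + (quartATwoDet A / 4)))) atTop (𝓝 0) := by
    have h := Literature.Analysis.tendsto_succ_pow_mul_of_abs_le (e := fun n => hatC4DTwo (stripYT 2) (n + 1) a b - (quartATwoDet A / 4 * (n : ℝ) ^ 4 + (quartBTwoDet A m₀ / 3
        - quartATwoDet A / 2) * (n : ℝ) ^ 3 + (quartATwoDet A / 4 - quartBTwoDet A m₀ / 2 + quartCTwoDet A m₀ m₂ / 2) * (n : ℝ) ^ 2 + (quartBTwoDet A m₀ / 6 - quartCTwoDet A m₀ m₂ / 2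
        + quartDTwoDet A m₀ m₂ m₃) * (n : ℝ) + m₄)) hR0 hR1 hb₄ 0
    simp only [pow_zero, one_mul] at h
    refine h.congr fun k => ?_
    ring
  have h4 := quartic_cancellation_four_two hT A
  have h3 := quartic_cancellation_three_two hT A m₀
  have h2 := quartic_cancellation_two_two hT A m₀ m₂
  have h := Literature.Analysis.tendsto_ratio_fourth_central_sub_linear (D := fun k => hatD 2 (stripYT 2) (k + 1) a b)
    (C := fun k => hatCD (stripYT 2) (k + 1) a b) (Q := fun k => hatC2D (stripYT 2) (k + 1) a b) (P := fun k => hatC3DTwo (stripYT 2) (k + 1) a b)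
    (S := fun k => hatC4DTwo (stripYT 2) (k + 1) a b) hAne h4 h3 h2 hD hC hQ hP hS
  rw [kurtRate_identity_two hT hAne m₀ m₂ m₃] at h
  refine ⟨_, h.congr fun k => ?_⟩
  simp only [fourthTopTwo, meanTopTwo]

/-- Corollary: `fourthTopTwo k a b / k → κ̂₄`. [cite: Feller1968, XIII.6; lane «pcv-sawmu» a-p2 g29] -/
theorem tendsto_fourthTopTwo_div (a b : Fin (2 * 2)) :
    Tendsto (fun k : ℕ => fourthTopTwo k a b / (k : ℝ)) atTop (𝓝 kappaHatFourTwo) := by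
  obtain ⟨W, h⟩ := tendsto_fourthTopTwo_sub_linear a b
  have hinv : Tendsto (fun k : ℕ => ((k : ℝ) + 1)⁻¹) atTop (𝓝 0) := by
    have := (tendsto_one_div_add_atTop_nhds_zero_nat : Tendsto (fun n : ℕ => 1 / ((n : ℝ) + 1)) atTop (𝓝 0))
    simpa using this
  have t := (h.mul hinv).add_const kappaHatFourTwo
  rw [mul_zero, zero_add] at t
  have t' : Tendsto (fun k : ℕ => fourthTopTwo (k + 1) a b / (((k + 1 : ℕ) : ℝ))) atTop (𝓝 kappaHatFourTwo) := by
    refine t.congr fun k => ?_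
    have hk : ((k : ℝ) + 1) ≠ 0 := by positivity
    push_cast
    field_simp
    ring
  exact (tendsto_add_atTop_iff_nat 1).1 t'

/-- ★★★ **PER STEP**: `fourthTopTwo k a b / (number of steps) → κ₄(T=2) = kappaStepFourTwo` (`= (3339420 − 2361331√2)/32`, §2) for every pair of end levels.
[cite: Feller1968, XIII.6; DuminilCopinHammond2013, §2.2; lane «pcv-sawmu» a-p2 g29 — own result, not in print] -/
theorem tendsto_fourthTopTwo_div_hatLen (a b : Fin (2 * 2)) :
    Tendsto (fun k : ℕ => fourthTopTwo k a b / ((hatLen k a b : ℤ) : ℝ)) atTop (𝓝 kappaStepFourTwo) := by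
  have t := (tendsto_fourthTopTwo_div a b).mul (tendsto_div_hatLen_two a b)
  rw [show kappaHatFourTwo * (1 / 2) = kappaStepFourTwo by rw [kappaStepFourTwo]; ring] at t
  refine t.congr' ?_
  filter_upwards [eventually_gt_atTop 0] with k hk
  have hk' : (k : ℝ) ≠ 0 := by exact_mod_cast hk.ne'
  field_simp

/-! ## §2 The exact value of `κ₄(T = 2)` -/

/-- `κ̂₃(T=2) = −2867/4 + 9785x²/4` (from «SKEWNESS» `kappaStepTwo_eq`). [cite: Feller1968, XIII.6; lane «pcv-sawmu» a-p2 g29] -/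
theorem kappaHatTwo_closed_form : kappaHatTwo = -2867 / 4 + 9785 / 4 * hexCriticalFugacity ^ 2 := by
  have h := kappaStepTwo_eq
  rw [kappaStepTwo, sqrt_two_eq] at h
  linarith

/-- ★ `κ̂₄(T=2) = −691621/8 + 2361331x²/8` (`= 834855/4 − 2361331√2/16`). [cite: Feller1968, XIII.6; lane «pcv-sawmu» a-p2 g29 — own computation] -/
theorem kappaHatFourTwo_closed_form : kappaHatFourTwo = -691621 / 8 + 2361331 / 8 * hexCriticalFugacity ^ 2 := by
  have h1 := tOneTwo_eq
  have h2 := tTwoTwo_eq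
  have h3 := tThreeTwo_eq
  have hy := tyTwo_eq
  have hly := tlyTwo_eq
  have hrr := trryTwo_eq
  have hT : tOneTwo ≠ 0 := (exists_hatCD_two_linear_det 0 0).1
  have hc2 : cTwoDetTwo = -39 / 4 + 73 / 2 * hexCriticalFugacity ^ 2 := by
    rw [cTwoDetTwo, div_eq_iff hT, cDetTwo_eq, h1, h2, hy, hly]
    linear_combination ((27/2 : ℝ) + (1 : ℝ) * hexCriticalFugacity ^ 2) * xc_minpoly
  rw [kappaHatFourTwo, div_eq_iff hT, kappaHatTwo_closed_form, hc2, cDetTwo_eq, h1, h2, h3, tFourTwo_eq, hy, hly, hrr, trrryTwo_eq]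
  linear_combination ((5520069/56 : ℝ) + (115937/7 : ℝ) * hexCriticalFugacity ^ 2 + (3555/7 : ℝ) * hexCriticalFugacity ^ 4
    + (-62/7 : ℝ) * hexCriticalFugacity ^ 6) * xc_minpoly

/-- ★★★ **`κ₄(T = 2) = (3339420 − 2361331√2)/32 = −0.19767…`** — the fourth cumulant rate of the surface-contact count of the critical width-two strip, an exact
element of `ℚ(√2)` (the venture's FINDING note had «≈ −0.198 (rough)»). [cite: Feller1968, XIII.6; lane «pcv-sawmu» a-p2 g29 — own result, not in print] -/
theorem kappaStepFourTwo_eq : kappaStepFourTwo = (3339420 - 2361331 * Real.sqrt 2) / 32 := by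
  rw [kappaStepFourTwo, kappaHatFourTwo_closed_form, sqrt_two_eq]
  ring

/-- `−0.1976704 < κ₄(T=2) < −0.1976703`. [cite: Feller1968, XIII.6; lane «pcv-sawmu» a-p2 g29] -/
theorem kappaStepFourTwo_window : (-0.1976704 : ℝ) < kappaStepFourTwo ∧ kappaStepFourTwo < (-0.1976703 : ℝ) := by
  obtain ⟨hr1, hr2⟩ := W3.sqrt_two_window15
  rw [kappaStepFourTwo_eq]
  constructor <;> linarith

end W2

end HV

end Literature.Probability.RandomPlanarGeometry.SAW
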